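import Literature.NumberTheory.Transcendental.RoyCriterionProofs
import HarnessLib

/-!
# Growth bookkeeping for the box principle with translates

(solo seat `solo-Schanuel-informed`, session 4; auxiliary to `SoloInformedRoyTranslateSharp`.)

Elementary real-analysis estimates used to run Dirichlet's box principle over Roy's box
`deg ≤ (N^{t₀}, N^{t₁})`, `H ≤ e^N` [Roy2001, Thm. 1] at the translates `(my, α^m)`,
`m ≤ N^{s₁}`, with derivatives `D^k`, `k ≤ N^{s₀}`:

* `eventually_translates_numerics` — the count `#forms · log ℓ < #unknowns · log (X+1)` in the
  form `8 x^{s₀+s₁} (…) < x^{1+t₀+t₁}`, valid eventually as soon as every exponent on the left is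
  `< 1 + t₀ + t₁`;
* `translate_coeff_bound_le_exp` — `((1+M₁)(1+|y|))^{T₀} (2e(1+|α|)^{M₁})^{T₁} ≤ exp(…)`;
* `factorial_le_exp_rpow` — `K! ≤ exp((s₀/ε₀) x^{s₀+ε₀})` for `K ≤ x^{s₀}`;
* `card_monomials_le_exp` — `(T₀+1)(T₁+1) ≤ exp(log 4 + (t₀+t₁) x)`.

All statements are folklore calculus; no transcendence input.
-/

noncomputable section

open Filter

namespace Summit.Schanuel.Schanuel.Theorems

open Literature.NumberTheory.Transcendental (eventually_mul_rpow_le_mul_rpow)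

/-! ### Numerics -/

/-- Growth bookkeeping for the box principle with translates (`σ = 1 + t₀ + t₁`, `S = s₀ + s₁`):
eventually `8 x^S (2 log 4 + σ x + (s₀/ε₀) x^{s₀+ε₀} + (log 2 + L_y) x^{t₀} + (s₁/ε₁) x^{t₀+ε₁}
+ (log 2 + 1) x^{t₁} + L_α x^{t₁+s₁} + x^u) < x^σ`. [folklore] -/
theorem eventually_translates_numerics {s₀ s₁ t₀ t₁ u ε₀ ε₁ : ℝ} (hs₁ : 0 ≤ s₁) (hu : 1 ≤ u)
    (H1 : s₀ + s₁ + u < 1 + t₀ + t₁) (hε₀ : 2 * s₀ + s₁ + ε₀ < 1 + t₀ + t₁)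
    (H4 : s₀ + s₁ + t₀ < 1 + t₀ + t₁) (hε₁ : s₀ + s₁ + t₀ + ε₁ < 1 + t₀ + t₁)
    (H5 : s₀ + 2 * s₁ + t₁ < 1 + t₀ + t₁) (Ly Lα : ℝ) :
    ∀ᶠ x : ℝ in atTop, 1 ≤ x ∧
      8 * x ^ (s₀ + s₁) * (2 * Real.log 4 + (1 + t₀ + t₁) * x + s₀ / ε₀ * x ^ (s₀ + ε₀) +
        (Real.log 2 + Ly) * x ^ t₀ + s₁ / ε₁ * x ^ (t₀ + ε₁) + (Real.log 2 + 1) * x ^ t₁ +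
        Lα * x ^ (t₁ + s₁) + x ^ u) < x ^ (1 + t₀ + t₁) := by
  set σ : ℝ := 1 + t₀ + t₁ with hσ
  set S : ℝ := s₀ + s₁ with hS
  have q : (0 : ℝ) < 1 / 9 := by norm_num
  have A₁ := eventually_mul_rpow_le_mul_rpow (16 * Real.log 4) (show S < σ by linarith) q
  have A₂ := eventually_mul_rpow_le_mul_rpow (8 * σ) (show S + 1 < σ by linarith) q
  have A₃ := eventually_mul_rpow_le_mul_rpow (8 * (s₀ / ε₀))
    (show S + (s₀ + ε₀) < σ by linarith) q
  have A₄ := eventually_mul_rpow_le_mul_rpow (8 * (Real.log 2 + Ly)) (show S + t₀ < σ by linarith) q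
  have A₅ := eventually_mul_rpow_le_mul_rpow (8 * (s₁ / ε₁)) (show S + (t₀ + ε₁) < σ by linarith) q
  have A₆ := eventually_mul_rpow_le_mul_rpow (8 * (Real.log 2 + 1)) (show S + t₁ < σ by linarith) q
  have A₇ := eventually_mul_rpow_le_mul_rpow (8 * Lα) (show S + (t₁ + s₁) < σ by linarith) q
  have A₈ := eventually_mul_rpow_le_mul_rpow 8 (show S + u < σ by linarith) q
  filter_upwards [eventually_ge_atTop 1, A₁, A₂, A₃, A₄, A₅, A₆, A₇, A₈]
    with x hx B₁ B₂ B₃ B₄ B₅ B₆ B₇ B₈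
  refine ⟨hx, ?_⟩
  have hx0 : 0 < x := one_pos.trans_le hx
  have hxσ : 0 < x ^ σ := Real.rpow_pos_of_pos hx0 _
  have e1 : x ^ S * x = x ^ (S + 1) := by rw [Real.rpow_add hx0 S 1, Real.rpow_one]
  have e : ∀ r : ℝ, x ^ S * x ^ r = x ^ (S + r) := fun r => by rw [Real.rpow_add hx0 S r]
  have expand : 8 * x ^ S * (2 * Real.log 4 + σ * x + s₀ / ε₀ * x ^ (s₀ + ε₀) +
      (Real.log 2 + Ly) * x ^ t₀ + s₁ / ε₁ * x ^ (t₀ + ε₁) + (Real.log 2 + 1) * x ^ t₁ +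
      Lα * x ^ (t₁ + s₁) + x ^ u) =
      16 * Real.log 4 * x ^ S + 8 * σ * x ^ (S + 1) + 8 * (s₀ / ε₀) * x ^ (S + (s₀ + ε₀)) +
      8 * (Real.log 2 + Ly) * x ^ (S + t₀) + 8 * (s₁ / ε₁) * x ^ (S + (t₀ + ε₁)) +
      8 * (Real.log 2 + 1) * x ^ (S + t₁) + 8 * Lα * x ^ (S + (t₁ + s₁)) + 8 * x ^ (S + u) := by
    rw [← e1, ← e, ← e, ← e, ← e, ← e, ← e]; ring
  rw [expand]
  linarith

/-! ### Growth lemmas -/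

/-- Logarithmic size of the uniform coefficient bound at the translates. [folklore] -/
theorem translate_coeff_bound_le_exp {x s₁ t₀ t₁ ε₁ : ℝ} (hx1 : 1 ≤ x) (hs₁ : 0 ≤ s₁)
    (hε₁ : 0 < ε₁) {T₀ T₁ M₁ : ℕ} (hT₀ : (T₀ : ℝ) ≤ x ^ t₀) (hT₁ : (T₁ : ℝ) ≤ x ^ t₁)
    (hM₁ : (M₁ : ℝ) ≤ x ^ s₁) (y α : ℂ) :
    ((1 + M₁) * (1 + ‖y‖)) ^ T₀ * (2 * (Real.exp 1 * (1 + ‖α‖) ^ M₁)) ^ T₁ ≤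
      Real.exp ((Real.log 2 + Real.log (1 + ‖y‖)) * x ^ t₀ + s₁ / ε₁ * x ^ (t₀ + ε₁) +
        ((Real.log 2 + 1) * x ^ t₁ + Real.log (1 + ‖α‖) * x ^ (t₁ + s₁))) := by
  have hx0 : 0 < x := one_pos.trans_le hx1
  have h1y : (1 : ℝ) ≤ 1 + ‖y‖ := by linarith [norm_nonneg y]
  have h1α : (1 : ℝ) ≤ 1 + ‖α‖ := by linarith [norm_nonneg α]
  have hLα0 : 0 ≤ Real.log (1 + ‖α‖) := Real.log_nonneg h1α
  have hb₀ : (1 : ℝ) ≤ (1 + M₁) * (1 + ‖y‖) :=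
    one_le_mul_of_one_le_of_one_le (by linarith [(Nat.cast_nonneg M₁ : (0 : ℝ) ≤ M₁)]) h1y
  have hb₁ : (1 : ℝ) ≤ 2 * (Real.exp 1 * (1 + ‖α‖) ^ M₁) := by
    have := one_le_mul_of_one_le_of_one_le (Real.one_le_exp zero_le_one)
      (one_le_pow₀ h1α (n := M₁))
    linarith
  have hM₁2 : (1 : ℝ) + M₁ ≤ 2 * x ^ s₁ := by linarith [Real.one_le_rpow hx1 hs₁]
  have hl₀ : Real.log ((1 + M₁) * (1 + ‖y‖)) ≤
      Real.log 2 + s₁ * (x ^ ε₁ / ε₁) + Real.log (1 + ‖y‖) := by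
    rw [Real.log_mul (by positivity) (by positivity)]
    have : Real.log (1 + M₁) ≤ Real.log 2 + s₁ * (x ^ ε₁ / ε₁) := by
      calc Real.log (1 + (M₁ : ℝ)) ≤ Real.log (2 * x ^ s₁) :=
            Real.log_le_log (by positivity) hM₁2
        _ = Real.log 2 + s₁ * Real.log x := by
            rw [Real.log_mul (by norm_num) (by positivity), Real.log_rpow hx0]
        _ ≤ Real.log 2 + s₁ * (x ^ ε₁ / ε₁) := by
            linarith [mul_le_mul_of_nonneg_left (Real.log_le_rpow_div hx0.le hε₁) hs₁]
    linarith
  have hl₁ : Real.log (2 * (Real.exp 1 * (1 + ‖α‖) ^ M₁)) ≤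
      Real.log 2 + 1 + x ^ s₁ * Real.log (1 + ‖α‖) := by
    rw [Real.log_mul (by norm_num) (by positivity), Real.log_mul (by positivity) (by positivity),
      Real.log_exp, Real.log_pow]
    have : (M₁ : ℝ) * Real.log (1 + ‖α‖) ≤ x ^ s₁ * Real.log (1 + ‖α‖) :=
      mul_le_mul_of_nonneg_right hM₁ hLα0
    linarith
  have g1 : ((1 + M₁) * (1 + ‖y‖)) ^ T₀ =
      Real.exp (T₀ * Real.log ((1 + M₁) * (1 + ‖y‖))) := by
    rw [Real.exp_nat_mul, Real.exp_log (by positivity)]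
  have g2 : (2 * (Real.exp 1 * (1 + ‖α‖) ^ M₁)) ^ T₁ =
      Real.exp (T₁ * Real.log (2 * (Real.exp 1 * (1 + ‖α‖) ^ M₁))) := by
    rw [Real.exp_nat_mul, Real.exp_log (by positivity)]
  rw [g1, g2, ← Real.exp_add]
  refine Real.exp_le_exp.2 (add_le_add ?_ ?_)
  · calc (T₀ : ℝ) * Real.log ((1 + M₁) * (1 + ‖y‖))
        ≤ x ^ t₀ * (Real.log 2 + s₁ * (x ^ ε₁ / ε₁) + Real.log (1 + ‖y‖)) :=
          mul_le_mul hT₀ hl₀ (Real.log_nonneg hb₀) (Real.rpow_nonneg hx0.le _)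
      _ = (Real.log 2 + Real.log (1 + ‖y‖)) * x ^ t₀ + s₁ / ε₁ * x ^ (t₀ + ε₁) := by
          rw [Real.rpow_add hx0]; field_simp; ring
  · calc (T₁ : ℝ) * Real.log (2 * (Real.exp 1 * (1 + ‖α‖) ^ M₁))
        ≤ x ^ t₁ * (Real.log 2 + 1 + x ^ s₁ * Real.log (1 + ‖α‖)) :=
          mul_le_mul hT₁ hl₁ (Real.log_nonneg hb₁) (Real.rpow_nonneg hx0.le _)
      _ = (Real.log 2 + 1) * x ^ t₁ + Real.log (1 + ‖α‖) * x ^ (t₁ + s₁) := by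
          rw [Real.rpow_add hx0]; ring

/-- `K! ≤ exp((s₀/ε₀) x^{s₀+ε₀})` for `K ≤ x^{s₀}`, `x ≥ 1`. [folklore] -/
theorem factorial_le_exp_rpow {x s₀ ε₀ : ℝ} (hx1 : 1 ≤ x) (hs₀ : 0 < s₀) (hε₀ : 0 < ε₀) {K : ℕ}
    (hK : (K : ℝ) ≤ x ^ s₀) : (K.factorial : ℝ) ≤ Real.exp (s₀ / ε₀ * x ^ (s₀ + ε₀)) := by
  have hx0 : 0 < x := one_pos.trans_le hx1
  have h1 : (K.factorial : ℝ) ≤ (K : ℝ) ^ K := by exact_mod_cast Nat.factorial_le_pow K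
  have h2 : Real.log (K.factorial : ℝ) ≤ K * Real.log K := by
    rw [← Real.log_pow]; exact Real.log_le_log (by positivity) h1
  have h3 : (K : ℝ) * Real.log K ≤ s₀ / ε₀ * x ^ (s₀ + ε₀) := by
    rcases Nat.eq_zero_or_pos K with hK0 | hKpos
    · rw [hK0]; simp only [Nat.cast_zero, zero_mul]
      exact (mul_pos (div_pos hs₀ hε₀) (Real.rpow_pos_of_pos hx0 _)).le
    · have hK1 : (1 : ℝ) ≤ K := by exact_mod_cast hKpos
      have h4 : Real.log K ≤ s₀ * (x ^ ε₀ / ε₀) := by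
        calc Real.log K ≤ Real.log (x ^ s₀) := Real.log_le_log (by linarith) hK
          _ = s₀ * Real.log x := Real.log_rpow hx0 s₀
          _ ≤ s₀ * (x ^ ε₀ / ε₀) :=
              mul_le_mul_of_nonneg_left (Real.log_le_rpow_div hx0.le hε₀) hs₀.le
      calc (K : ℝ) * Real.log K ≤ x ^ s₀ * (s₀ * (x ^ ε₀ / ε₀)) :=
            mul_le_mul hK h4 (Real.log_nonneg hK1) (Real.rpow_nonneg hx0.le _)
        _ = s₀ / ε₀ * x ^ (s₀ + ε₀) := by rw [Real.rpow_add hx0]; field_simp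
  calc (K.factorial : ℝ) = Real.exp (Real.log (K.factorial : ℝ)) :=
        (Real.exp_log (by positivity)).symm
    _ ≤ Real.exp (s₀ / ε₀ * x ^ (s₀ + ε₀)) := Real.exp_le_exp.2 (h2.trans h3)

/-- `(T₀+1)(T₁+1) ≤ exp(log 4 + (t₀+t₁) x)` for `T_i ≤ x^{t_i}`, `x ≥ 1`. [folklore] -/
theorem card_monomials_le_exp {x t₀ t₁ : ℝ} (hx1 : 1 ≤ x) (ht₀ : 0 ≤ t₀) (ht₁ : 0 ≤ t₁)
    {T₀ T₁ : ℕ} (hT₀ : (T₀ : ℝ) ≤ x ^ t₀) (hT₁ : (T₁ : ℝ) ≤ x ^ t₁) :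
    (((T₀ + 1) * (T₁ + 1) : ℕ) : ℝ) ≤ Real.exp (Real.log 4 + (t₀ + t₁) * x) := by
  have hx0 : 0 < x := one_pos.trans_le hx1
  have hlogx : Real.log x ≤ x := by linarith [Real.log_le_sub_one_of_pos hx0]
  have h1 : (((T₀ + 1) * (T₁ + 1) : ℕ) : ℝ) ≤ 4 * x ^ (t₀ + t₁) := by
    push_cast
    have a1 : (T₀ : ℝ) + 1 ≤ 2 * x ^ t₀ := by linarith [Real.one_le_rpow hx1 ht₀]
    have a2 : (T₁ : ℝ) + 1 ≤ 2 * x ^ t₁ := by linarith [Real.one_le_rpow hx1 ht₁]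
    calc ((T₀ : ℝ) + 1) * ((T₁ : ℝ) + 1) ≤ (2 * x ^ t₀) * (2 * x ^ t₁) :=
          mul_le_mul a1 a2 (by positivity) (by positivity)
      _ = 4 * x ^ (t₀ + t₁) := by rw [Real.rpow_add hx0]; ring
  have h2 : x ^ (t₀ + t₁) ≤ Real.exp ((t₀ + t₁) * x) := by
    rw [Real.rpow_def_of_pos hx0, mul_comm]
    exact Real.exp_le_exp.2 (mul_le_mul_of_nonneg_left hlogx (by linarith))
  calc (((T₀ + 1) * (T₁ + 1) : ℕ) : ℝ) ≤ 4 * x ^ (t₀ + t₁) := h1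
    _ ≤ 4 * Real.exp ((t₀ + t₁) * x) := by linarith
    _ = Real.exp (Real.log 4 + (t₀ + t₁) * x) := by
        rw [Real.exp_add, Real.exp_log (by norm_num)]

end Summit.Schanuel.Schanuel.Theorems

end
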